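import Summits.AtomisticToContinuum.Crystallization.Theorems.ChartedPlanarOrderPatternPairGeometry
import Summits.AtomisticToContinuum.Crystallization.Theorems.ChartedPlanarOrderPatternSiteTables

/-!
# ChartedPlanarOrder — the pattern frame of a period pair (`PatternFrame`)

decomp-a2c lens-3 (generation 23/24; N = `Theses.ChartedPlanarOrder.ChartedZeroExcessLayered`, PS column).
Real-level form of the integer site tables (`…PatternLayerTables`, `…PatternPairGeometry` §1, `…PatternSiteTables`)
for a PERIOD PAIR `x ≠ ±y` of first-shell vectors of a two-shell pattern `P` with `−x, −y ∈ P`: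
`exists_normal_site_data` extends `…PatternPairGeometry.exists_normal_height_classes` (same unit normal
`n = unitNormal v w` of the integer shadows) by three clauses the layering dichotomy consumes:

* (C1) IN-PLANE SITES ARE PERIOD COMBINATIONS: `⟪n, z⟫ = 0 → z = i • x + j • y`, `i, j ∈ {−1, 0, 1}`;
* (C2) SQUARE second shell: `h = √2/2 → ‖z‖ ≠ 1 → ⟪n, z⟫ ∈ {0, ±2h}` (in-plane diagonal or straight above/below);
* (C3) SQUARE HOLLOW REGISTRY: `h = √2/2 → ‖z‖ = 1 → ⟪n, z⟫ ≠ 0 → ⟪z, x⟫, ⟪z, y⟫ ∈ {±1/2}`.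
-/

open scoped RealInnerProductSpace
open Literature.Geometry.DiscreteGeometry
open Summit.AtomisticToContinuum.Crystallization.Theorems.ChartedPlanarOrderPatternLayerTables (crossInt)
open Summit.AtomisticToContinuum.Crystallization.Theorems.ChartedPlanarOrderPatternPairGeometry
open Summit.AtomisticToContinuum.Crystallization.Theorems.ChartedPlanarOrderPatternSiteTables

namespace Summit.AtomisticToContinuum.Crystallization.Theorems.ChartedPlanarOrderPatternFrame

-- (gate-forced delta, hand-2 g10: the top-level local twin `norm_scaled_eq_one'` of the tree's `norm_scaled_intVec`
-- (PricedLinkCensusSoftLayerPropagationStubShadowSigns — not built on the farm at landing time, so not importable today) was removed on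
-- dedup.landed and re-introduced as a local `have` inside the two proofs that use it; every statement below is byte-identical.)

/-- transfer of an integer combination `u = i v + j w` to the scaled vectors. -/
theorem scaled_combo (N : ℕ) {u v w : Fin 3 → ℤ} {i j : ℤ} (h : u = fun k => i * v k + j * w k) :
    ((Real.sqrt N)⁻¹ • intVec u : EuclideanSpace ℝ (Fin 3)) =
      (i : ℝ) • ((Real.sqrt N)⁻¹ • intVec v) + (j : ℝ) • ((Real.sqrt N)⁻¹ • intVec w) := by
  have hu : intVec u = (i : ℝ) • intVec v + (j : ℝ) • intVec w := by
    ext k; simp [intVec, h]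
  rw [hu, smul_add, smul_comm _ (i : ℝ), smul_comm _ (j : ℝ)]

/-- the norm of a scaled table vector is `1` iff its squared integer norm is `N` (for tables with norms `N | 2N`). -/
theorem sqNorm_eq_two_mul_of_norm_ne_one {N : ℕ} (hN : N ≠ 0) {T : Finset (Fin 3 → ℤ)}
    (hT : ∀ v ∈ T, sqNormInt v = N ∨ sqNormInt v = 2 * N) {u : Fin 3 → ℤ} (hu : u ∈ T)
    (h1 : ‖((Real.sqrt N)⁻¹ • intVec u : EuclideanSpace ℝ (Fin 3))‖ ≠ 1) : sqNormInt u = 2 * N := by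
  have norm_scaled_eq_one' : ∀ {N : ℕ}, N ≠ 0 → ∀ {u : Fin 3 → ℤ}, sqNormInt u = N →
      ‖((Real.sqrt N)⁻¹ • intVec u : EuclideanSpace ℝ (Fin 3))‖ = 1 := by
    intro N hN u hu
    have hpos : (0 : ℝ) < Real.sqrt N := by positivity
    rw [norm_smul, norm_inv, Real.norm_of_nonneg hpos.le, norm_intVec, hu, Int.cast_natCast, inv_mul_cancel₀ hpos.ne']
  rcases hT u hu with h | h
  · exact absurd (norm_scaled_eq_one' hN h) h1
  · exact h

/-- ★★ NORMAL, HEIGHT CLASSES AND SITE DATA of a period pair.  For first-shell `x ≠ ±y` of a two-shell pattern `P`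
with `−x, −y ∈ P` there are a unit normal `n ⊥ x, y` and a spacing `h` (`√6/3` for TRIANGULAR pairs `⟪x,y⟫ = ±1/2`,
`√2/2` for SQUARE pairs `⟪x,y⟫ = 0`, fcc only) with: all heights `⟪n,z⟫ ∈ {0, ±h, ±2h}`; first-shell (and, for
triangular pairs, all) heights `∈ {0, ±h}`; up- and down-sites exist; (C1) in-plane sites are `i x + j y`,
`i, j ∈ {−1,0,1}`; (C2) square second shell `⊂ {0, ±2h}`; (C3) square off-plane first shell has hollow registry. -/
theorem exists_normal_site_data {P : Finset (EuclideanSpace ℝ (Fin 3))} (hP : P = fccTwoShellPattern ∨ P = hcpTwoShellPattern)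
    {x y : EuclideanSpace ℝ (Fin 3)} (hx : x ∈ P) (hy : y ∈ P) (hx1 : ‖x‖ = 1) (hy1 : ‖y‖ = 1) (hnx : -x ∈ P) (hny : -y ∈ P)
    (hxy : x ≠ y) (hxy' : x + y ≠ 0) :
    ∃ n : EuclideanSpace ℝ (Fin 3), ‖n‖ = 1 ∧ ⟪n, x⟫ = 0 ∧ ⟪n, y⟫ = 0 ∧ ∃ h : ℝ,
      ((h = Real.sqrt 6 / 3 ∧ (⟪x, y⟫ = 1 / 2 ∨ ⟪x, y⟫ = -1 / 2)) ∨ (h = Real.sqrt 2 / 2 ∧ ⟪x, y⟫ = 0 ∧ P = fccTwoShellPattern)) ∧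
      (∀ z ∈ P, ⟪n, z⟫ = 0 ∨ ⟪n, z⟫ = h ∨ ⟪n, z⟫ = -h ∨ ⟪n, z⟫ = 2 * h ∨ ⟪n, z⟫ = -(2 * h)) ∧
      (∀ z ∈ P, (‖z‖ = 1 ∨ h = Real.sqrt 6 / 3) → ⟪n, z⟫ = 0 ∨ ⟪n, z⟫ = h ∨ ⟪n, z⟫ = -h) ∧
      (∃ z ∈ P, ‖z‖ = 1 ∧ ⟪n, z⟫ = h) ∧ (∃ z ∈ P, ‖z‖ = 1 ∧ ⟪n, z⟫ = -h) ∧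
      (∀ z ∈ P, ⟪n, z⟫ = 0 → ∃ i j : ℤ, (i = -1 ∨ i = 0 ∨ i = 1) ∧ (j = -1 ∨ j = 0 ∨ j = 1) ∧ z = (i : ℝ) • x + (j : ℝ) • y) ∧
      (∀ z ∈ P, h = Real.sqrt 2 / 2 → ‖z‖ ≠ 1 → ⟪n, z⟫ = 0 ∨ ⟪n, z⟫ = 2 * h ∨ ⟪n, z⟫ = -(2 * h)) ∧
      (∀ z ∈ P, h = Real.sqrt 2 / 2 → ‖z‖ = 1 → ⟪n, z⟫ ≠ 0 →
        (⟪z, x⟫ = 1 / 2 ∨ ⟪z, x⟫ = -1 / 2) ∧ (⟪z, y⟫ = 1 / 2 ∨ ⟪z, y⟫ = -1 / 2)) := by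
  have norm_scaled_eq_one' : ∀ {N : ℕ}, N ≠ 0 → ∀ {u : Fin 3 → ℤ}, sqNormInt u = N →
      ‖((Real.sqrt N)⁻¹ • intVec u : EuclideanSpace ℝ (Fin 3))‖ = 1 := by
    intro N hN u hu
    have hpos : (0 : ℝ) < Real.sqrt N := by positivity
    rw [norm_smul, norm_inv, Real.norm_of_nonneg hpos.le, norm_intVec, hu, Int.cast_natCast, inv_mul_cancel₀ hpos.ne']
  have h62 : Real.sqrt 6 / 3 ≠ Real.sqrt 2 / 2 := by
    intro h
    have h' := congrArg (fun r : ℝ => r ^ 2) h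
    simp only [div_pow, Real.sq_sqrt (show (0:ℝ) ≤ 2 by norm_num), Real.sq_sqrt (show (0:ℝ) ≤ 6 by norm_num)] at h'
    norm_num at h'
  have hmem3 : ∀ {i : ℤ}, i ∈ ({-1, 0, 1} : Finset ℤ) → i = -1 ∨ i = 0 ∨ i = 1 := by
    intro i hi; simpa using hi
  rcases hP with rfl | rfl
  · -- fcc
    obtain ⟨v, hv, rfl⟩ := Finset.mem_image.1 hx
    obtain ⟨w, hw, rfl⟩ := Finset.mem_image.1 hy
    have hv2 := sqNorm_eq_of_norm_eq_one two_ne_zero fcc_sqNorm_cases hv hx1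
    have hw2 := sqNorm_eq_of_norm_eq_one two_ne_zero fcc_sqNorm_cases hw hy1
    have hne : v ≠ w := fun h => hxy (by rw [h])
    have hne' : v + w ≠ 0 := by
      intro h; apply hxy'; rw [← smul_add, ← intVec_add, h, smul_eq_zero]; right; ext i; simp [intVec]
    obtain ⟨hall, hfirst, hD3, hD4, ⟨uU, huU, huU2, huUt⟩, ⟨uD, huD, huD2, huDt⟩⟩ := fcc_pair_heights v hv w hw hv2 hw2 hne hne'
    have hdot := fcc_pair_dot v hv w hw hv2 hw2 hne hne'
    have hxyval : ⟪((Real.sqrt (2 : ℕ))⁻¹ • intVec v : EuclideanSpace ℝ (Fin 3)), (Real.sqrt (2 : ℕ))⁻¹ • intVec w⟫ = (dotInt v w : ℝ) / 2 := by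
      rw [inner_scaled two_ne_zero]; norm_num
    -- (C1) is type-independent
    have hC1 : ∀ (D : ℤ), sqNormInt (crossInt v w) = D → D ≠ 0 →
        ∀ z ∈ scaledPattern (fccInt ∪ fccSecondShellInt) 2, ⟪unitNormal v w, z⟫ = 0 →
        ∃ i j : ℤ, (i = -1 ∨ i = 0 ∨ i = 1) ∧ (j = -1 ∨ j = 0 ∨ j = 1) ∧
          z = (i : ℝ) • ((Real.sqrt (2 : ℕ))⁻¹ • intVec v) + (j : ℝ) • ((Real.sqrt (2 : ℕ))⁻¹ • intVec w) := by
      intro D hD hD0 z hz h0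
      obtain ⟨u, hu, rfl⟩ := Finset.mem_image.1 hz
      rw [inner_unitNormal_scaled, hD, div_eq_zero_iff] at h0
      have h0' : dotInt u (crossInt v w) = 0 := by
        rcases h0 with h0 | h0
        · exact_mod_cast h0
        · exfalso
          have : (0 : ℝ) < Real.sqrt D * Real.sqrt (2 : ℕ) := by
            have hDpos : (0 : ℝ) < D := by
              have : (0 : ℤ) ≤ sqNormInt (crossInt v w) := by unfold sqNormInt; positivity
              exact_mod_cast lt_of_le_of_ne (hD ▸ this) (Ne.symm hD0)
            positivity
          exact this.ne' h0
      obtain ⟨i, hi, j, hj, huij⟩ := fcc_inplane_combo v hv w hw hv2 hw2 hne hne' u hu h0'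
      exact ⟨i, j, hmem3 hi, hmem3 hj, scaled_combo 2 huij⟩
    by_cases hd0 : dotInt v w = 0
    · -- SQUARE pair
      have hD : sqNormInt (crossInt v w) = 4 := hD4 hd0
      have hD0 : sqNormInt (crossInt v w) ≠ 0 := by rw [hD]; norm_num
      refine ⟨unitNormal v w, norm_unitNormal hD0, inner_unitNormal_fst _ _ _, inner_unitNormal_snd _ _ _, Real.sqrt 2 / 2,
        Or.inr ⟨rfl, by rw [hxyval, hd0]; norm_num, rfl⟩, ?_, ?_, ?_, ?_, hC1 4 hD (by norm_num), ?_, ?_⟩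
      · intro z hz
        obtain ⟨u, hu, rfl⟩ := Finset.mem_image.1 hz
        rw [inner_unitNormal_scaled, hD]; push_cast
        rw [← two_div_sqrt_four_mul_sqrt_two]
        rcases hall u hu with h | h | h | h | h <;> rw [h] <;> norm_num [div_eq_mul_inv] <;> ring_nf <;> norm_num
      · intro z hz hz1
        obtain ⟨u, hu, rfl⟩ := Finset.mem_image.1 hz
        have hu2 : sqNormInt u = 2 := by
          rcases hz1 with h1 | h1
          · exact_mod_cast sqNorm_eq_of_norm_eq_one two_ne_zero fcc_sqNorm_cases hu h1
          · exact absurd h1.symm h62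
        rw [inner_unitNormal_scaled, hD]; push_cast
        rw [← two_div_sqrt_four_mul_sqrt_two]
        rcases hfirst u hu (Or.inl hu2) with h | h | h <;> rw [h] <;> norm_num [div_eq_mul_inv]
      · refine ⟨_, Finset.mem_image_of_mem _ huU, norm_scaled_eq_one' two_ne_zero (by exact_mod_cast huU2), ?_⟩
        rw [inner_unitNormal_scaled, hD, huUt]; push_cast; exact two_div_sqrt_four_mul_sqrt_two
      · refine ⟨_, Finset.mem_image_of_mem _ huD, norm_scaled_eq_one' two_ne_zero (by exact_mod_cast huD2), ?_⟩
        rw [inner_unitNormal_scaled, hD, huDt]; push_cast; rw [neg_div, two_div_sqrt_four_mul_sqrt_two]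
      · -- (C2) square second shell ⊂ {0, ±2h}
        intro z hz _ hz1
        obtain ⟨u, hu, rfl⟩ := Finset.mem_image.1 hz
        have hu4 : sqNormInt u = 4 := by
          have := sqNorm_eq_two_mul_of_norm_ne_one two_ne_zero fcc_sqNorm_cases hu hz1; simpa using this
        rw [inner_unitNormal_scaled, hD]; push_cast
        have h2 : 2 * (Real.sqrt 2 / 2) = (4 : ℝ) / (Real.sqrt 4 * Real.sqrt 2) := by
          rw [← two_div_sqrt_four_mul_sqrt_two]; ring
        rw [h2]
        rcases fcc_square_second_heights v hv w hw hv2 hw2 hne hne' hd0 u hu hu4 with h | h | h <;> rw [h] <;> norm_num [neg_div]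
      · -- (C3) square hollow registry
        intro z hz _ hz1 hz0
        obtain ⟨u, hu, rfl⟩ := Finset.mem_image.1 hz
        have hu2 : sqNormInt u = 2 := by exact_mod_cast sqNorm_eq_of_norm_eq_one two_ne_zero fcc_sqNorm_cases hu hz1
        have hu0 : dotInt u (crossInt v w) ≠ 0 := by
          intro h; apply hz0; rw [inner_unitNormal_scaled, h]; simp
        obtain ⟨h1, h2⟩ := fcc_square_hollow v hv w hw hv2 hw2 hne hne' hd0 u hu hu2 hu0
        refine ⟨?_, ?_⟩
        · rw [inner_scaled two_ne_zero]; rcases h1 with h | h <;> rw [h] <;> norm_num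
        · rw [inner_scaled two_ne_zero]; rcases h2 with h | h <;> rw [h] <;> norm_num
    · -- TRIANGULAR pair
      have hD : sqNormInt (crossInt v w) = 3 := hD3 hd0
      have hD0 : sqNormInt (crossInt v w) ≠ 0 := by rw [hD]; norm_num
      have hpm : ⟪((Real.sqrt (2 : ℕ))⁻¹ • intVec v : EuclideanSpace ℝ (Fin 3)), (Real.sqrt (2 : ℕ))⁻¹ • intVec w⟫ = 1 / 2 ∨
          ⟪((Real.sqrt (2 : ℕ))⁻¹ • intVec v : EuclideanSpace ℝ (Fin 3)), (Real.sqrt (2 : ℕ))⁻¹ • intVec w⟫ = -1 / 2 := by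
        rw [hxyval]; rcases hdot with h | h | h
        · left; rw [h]; norm_num
        · exact absurd h hd0
        · right; rw [h]; norm_num
      have hcls : ∀ z ∈ scaledPattern (fccInt ∪ fccSecondShellInt) 2, ⟪unitNormal v w, z⟫ = 0 ∨ ⟪unitNormal v w, z⟫ = Real.sqrt 6 / 3 ∨
          ⟪unitNormal v w, z⟫ = -(Real.sqrt 6 / 3) := by
        intro z hz
        obtain ⟨u, hu, rfl⟩ := Finset.mem_image.1 hz
        rw [inner_unitNormal_scaled, hD]; push_cast
        rw [← two_div_sqrt_three_mul_sqrt_two]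
        rcases hfirst u hu (Or.inr hd0) with h | h | h <;> rw [h] <;> norm_num [neg_div]
      refine ⟨unitNormal v w, norm_unitNormal hD0, inner_unitNormal_fst _ _ _, inner_unitNormal_snd _ _ _, Real.sqrt 6 / 3,
        Or.inl ⟨rfl, hpm⟩, ?_, fun z hz _ => hcls z hz, ?_, ?_, hC1 3 hD (by norm_num), fun z _ h _ => absurd h h62,
        fun z _ h _ _ => absurd h h62⟩
      · intro z hz; rcases hcls z hz with h | h | h
        · exact Or.inl h
        · exact Or.inr (Or.inl h)
        · exact Or.inr (Or.inr (Or.inl h))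
      · refine ⟨_, Finset.mem_image_of_mem _ huU, norm_scaled_eq_one' two_ne_zero (by exact_mod_cast huU2), ?_⟩
        rw [inner_unitNormal_scaled, hD, huUt]; push_cast; exact two_div_sqrt_three_mul_sqrt_two
      · refine ⟨_, Finset.mem_image_of_mem _ huD, norm_scaled_eq_one' two_ne_zero (by exact_mod_cast huD2), ?_⟩
        rw [inner_unitNormal_scaled, hD, huDt]; push_cast; rw [neg_div, two_div_sqrt_three_mul_sqrt_two]
  · -- hcp: always triangular
    obtain ⟨v, hv, rfl⟩ := Finset.mem_image.1 hx
    obtain ⟨w, hw, rfl⟩ := Finset.mem_image.1 hy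
    have h18 : (18 : ℕ) ≠ 0 := by norm_num
    have hv2 := sqNorm_eq_of_norm_eq_one h18 hcp_sqNorm_cases hv hx1
    have hw2 := sqNorm_eq_of_norm_eq_one h18 hcp_sqNorm_cases hw hy1
    have hne : v ≠ w := fun h => hxy (by rw [h])
    have hne' : v + w ≠ 0 := by
      intro h; apply hxy'; rw [← smul_add, ← intVec_add, h, smul_eq_zero]; right; ext i; simp [intVec]
    have hnv := neg_mem_table h18 hnx
    have hnw := neg_mem_table h18 hny
    obtain ⟨hall, hD, ⟨uU, huU, huU2, huUt⟩, ⟨uD, huD, huD2, huDt⟩⟩ := hcp_pair_heights v hv w hw hv2 hw2 hnv hnw hne hne'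
    have hdot := hcp_pair_dot v hv w hw hv2 hw2 hnv hnw hne hne'
    have hD0 : sqNormInt (crossInt v w) ≠ 0 := by rw [hD]; norm_num
    have hpm : ⟪((Real.sqrt (18 : ℕ))⁻¹ • intVec v : EuclideanSpace ℝ (Fin 3)), (Real.sqrt (18 : ℕ))⁻¹ • intVec w⟫ = 1 / 2 ∨
        ⟪((Real.sqrt (18 : ℕ))⁻¹ • intVec v : EuclideanSpace ℝ (Fin 3)), (Real.sqrt (18 : ℕ))⁻¹ • intVec w⟫ = -1 / 2 := by
      rw [inner_scaled h18]; rcases hdot with h | h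
      · left; rw [h]; norm_num
      · right; rw [h]; norm_num
    have hcls : ∀ z ∈ scaledPattern (hcpInt ∪ hcpSecondShellInt) 18, ⟪unitNormal v w, z⟫ = 0 ∨ ⟪unitNormal v w, z⟫ = Real.sqrt 6 / 3 ∨
        ⟪unitNormal v w, z⟫ = -(Real.sqrt 6 / 3) := by
      intro z hz
      obtain ⟨u, hu, rfl⟩ := Finset.mem_image.1 hz
      rw [inner_unitNormal_scaled, hD]; push_cast
      rw [← div_sqrt_243_mul_sqrt_18]
      rcases hall u hu with h | h | h <;> rw [h] <;> norm_num [neg_div]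
    have hC1 : ∀ z ∈ scaledPattern (hcpInt ∪ hcpSecondShellInt) 18, ⟪unitNormal v w, z⟫ = 0 →
        ∃ i j : ℤ, (i = -1 ∨ i = 0 ∨ i = 1) ∧ (j = -1 ∨ j = 0 ∨ j = 1) ∧
          z = (i : ℝ) • ((Real.sqrt (18 : ℕ))⁻¹ • intVec v) + (j : ℝ) • ((Real.sqrt (18 : ℕ))⁻¹ • intVec w) := by
      intro z hz h0
      obtain ⟨u, hu, rfl⟩ := Finset.mem_image.1 hz
      rw [inner_unitNormal_scaled, hD, div_eq_zero_iff] at h0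
      have h0' : dotInt u (crossInt v w) = 0 := by
        rcases h0 with h0 | h0
        · exact_mod_cast h0
        · exfalso; have : (0 : ℝ) < Real.sqrt (243 : ℤ) * Real.sqrt (18 : ℕ) := by positivity
          exact this.ne' h0
      obtain ⟨i, hi, j, hj, huij⟩ := hcp_inplane_combo v hv w hw hv2 hw2 hnv hnw hne hne' u hu h0'
      exact ⟨i, j, hmem3 hi, hmem3 hj, scaled_combo 18 huij⟩
    refine ⟨unitNormal v w, norm_unitNormal hD0, inner_unitNormal_fst _ _ _, inner_unitNormal_snd _ _ _, Real.sqrt 6 / 3,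
      Or.inl ⟨rfl, hpm⟩, ?_, fun z hz _ => hcls z hz, ?_, ?_, hC1, fun z _ h _ => absurd h h62, fun z _ h _ _ => absurd h h62⟩
    · intro z hz; rcases hcls z hz with h | h | h
      · exact Or.inl h
      · exact Or.inr (Or.inl h)
      · exact Or.inr (Or.inr (Or.inl h))
    · refine ⟨_, Finset.mem_image_of_mem _ huU, norm_scaled_eq_one' h18 (by exact_mod_cast huU2), ?_⟩
      rw [inner_unitNormal_scaled, hD, huUt]; push_cast; exact div_sqrt_243_mul_sqrt_18
    · refine ⟨_, Finset.mem_image_of_mem _ huD, norm_scaled_eq_one' h18 (by exact_mod_cast huD2), ?_⟩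
      rw [inner_unitNormal_scaled, hD, huDt]; push_cast; rw [neg_div, div_sqrt_243_mul_sqrt_18]

end Summit.AtomisticToContinuum.Crystallization.Theorems.ChartedPlanarOrderPatternFrame
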